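import Literature.NumberTheory.EllipticCurves.Rank1Residual.MuLeFineMuCarrier
import Literature.NumberTheory.EllipticCurves.Rank1Residual.X9MuInvariant
import Literature.NumberTheory.EllipticCurves.Rank1Residual.FineMordellWeilCertificates
import Literature.NumberTheory.EllipticCurves.Rank1Residual.Typed.Basic
import Literature.NumberTheory.EllipticCurves.IwasawaLeadingTerm
import Literature.NumberTheory.EllipticCurves.IwasawaLeadingTermProofs
import Literature.NumberTheory.EllipticCurves.CyclotomicPAdicHeight
import Literature.NumberTheory.EllipticCurves.CanonicalPAdicHeight
import Literature.NumberTheory.EllipticCurves.PAdicBSDProofs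
import Literature.NumberTheory.EllipticCurves.IwasawaSelmerModuleFiniteProofs
import Literature.NumberTheory.EllipticCurves.GreenbergVatsal2000.CongruentCurves
import Literature.NumberTheory.EllipticCurves.Sha
import Literature.NumberTheory.EllipticCurves.MordellWeil
import Literature.NumberTheory.EllipticCurves.Tamagawa
import Literature.NumberTheory.EllipticCurves.MordellWeilTheoremProofs
import HarnessLib
set_option autoImplicit false

/-!
# REGULAR PRIMES (Stein–Wuthrich) and the HEIGHT / L-VALUE VALUATION MATCH at a pair `(E, p)`:
# the layer-0, `L`-free reading of the Perrin-Riou–Schneider leading-term formula, its consequences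
# `μ(X(E/ℚ_∞)) = 0` / Kato divisibility / `BSD(E,p)` per pair, and the descent Ш-gate — definitions
# and proved per-pair theorems only (nothing open is asserted)

For `p ≥ 5` good ordinary, `Ш(E/ℚ)[p^∞]` finite and THE canonical cyclotomic `p`-adic height datum
`W.cyclotomicPAdicHeight p`, the tree fact `Schneider1985_order_charGenerator` (Perrin-Riou 1982/84,
Schneider 1985, as printed in Stein–Wuthrich, Math. Comp. 82 (2013) Thm. 6.1, p. 20: «the leading term of
the series `f_E(T)` has the same valuation as `ε_p · ∏ c_v · #Ш(E/ℚ)(p) / (#E(ℚ)(p))² · Reg_γ(E/ℚ)`»)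
says `[T^r] f_E · log_p(γ)^r · #tors² = u · (1 − α⁻¹)² · #Ш[p^∞] · Reg_p · ∏ c_ℓ` with `u ∈ ℤ_pˣ`.  Hence:

* §1 `RegularPrimeAt W p` — «`p` is a REGULAR prime for `E`» (Stein–Wuthrich, the sentence after
  Thm. 6.1: «if the valuation of the leading term of `f_E(T)` is positive we call `p` an irregular prime
  for `E`»), typed on the RIGHT side of the formula as an identity of `p`-adic norms; §2 proves, per pair
  and by name from the tree facts: Schneider's non-degeneracy for the canonical datum
  (`RegularPrimeAt.schneiderConjecture`), `‖[T^r] f_E‖ = 1` (`.norm_coeff_rank_eq_one`), `μ(X(E/ℚ_∞)) = 0`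
  for every cyclotomic dual datum (`.muAlgZeroAt`, cotorsion from BCS 2025 Thm. 1.1.2 (a) at an
  irreducible `E[p]`), Kato's integral divisibility at the pair (`.katoDivisibilityAt`, through
  `MuAlgZeroAt.katoDivisibilityAt`) and, in analytic rank 1 on class X9 with `μ(𝓛_p(E)) = 0`, Miller's
  `BSD(E,p)` (`bsdp_of_regularPrimeAt_of_muAnZeroAt`).
* §3 `HeightLValueMatchAt W p` — the Ш-FREE `p`-adic BSD leading-term VALUATION identity
  `‖[T^r] L_p(f, α)‖ · ‖log_p(γ)^r · #tors²‖ = ‖(1 − α⁻¹)² · Reg_p · ∏ c_ℓ‖` with `[T^r] L_p ≠ 0` (a per-pair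
  numerical certificate); proved: it forces Schneider for the canonical datum, pins the BCS `μ`-defect to
  `‖p^k‖ = ‖#Ш(E)[p^∞]‖` for EVERY datum and generator (`.norm_defect_eq_norm_card_sha` — «`μ` lives in
  `Ш`»), hence with `p ∤ #Ш(E)[p^∞]` the defect is `≤ 0` (`.muDefectNonposAt`), with `μ(𝓛_p) = 0` moreover
  `μ(X) = 0` (`.muAlgZeroAt`), Kato divisibility at the pair and `BSD(E,p)` in analytic rank 1 on X9.
* §4 the DESCENT Ш-gate and the Ш-cell door: `Ш(E/ℚ)[p] = 0` (`ShaPTorsionFreeAt`, decided by a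
  `p`-descent) gives `Ш(E/ℚ)[p^∞] = 0`, `#Ш[p^∞] = 1`, `p ∤ #Ш[p^∞]` (Miller 2011 §6, Example 6.4: «hence
  `#Ш(ℚ,E)[5] = 1` … the 5-primary part of `Ш(ℚ,E)` is trivial»); `Reg_p = 1` at Mordell–Weil rank 0 so
  MATCH is then exact arithmetic (`heightLValueMatchAt_iff_of_rank_zero`); and a descent LOWER bound
  `ShaPRankAtLeast W p d` of the same exponent as an Euler-system upper bound gives Miller's `BSD(E,p)`
  (`bsdp_of_missingUpperBoundAt_of_shaPRankAtLeast`; Miller 2011 Thm. 7.1–7.2 proofs: «a 3-descent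
  proves `Ш(ℚ,E)[3] ≅ (ℤ/3ℤ)²` … the algorithm of Stein and Wuthrich proves the desired upper bound»).

Ported verbatim (names, statements, proofs) from the cell sketch `run/shared/lean/pub/bsd-f3-mu/desc/
Sketch7.lean` (sha16 433aa2f37f3eda0d, rc 0; refuter audit REF1-AUDIT §3.9: axioms standard 11/11) onto
the tree namespace; the sketch's `muDefectNonposAt_of_muAlgZeroAt` is replaced by the tree theorem
`MuAlgZeroAt.katoDivisibilityAt` (`MuLeFineMuCarrier`), and the class-level statements (`RegularPrimeX9R1`,
`MatchX9R1`, `MatchX9R0`, `DescentMatchX9`) live Summits-side (`SmallImageMu/HeightLValueMatchCriteria`).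

## References
* [SteinWuthrich2013] W. Stein, C. Wuthrich, Algorithms for the arithmetic of elliptic curves using
  Iwasawa theory, Math. Comp. 82 (2013) 1757–1792 — §5.1 Conj. 5.1 (p. 18), §6.1 Thm. 6.1 and the
  paragraph after it (p. 20), §4.2 (the `p`-adic regulator), §8 (pp. 27–28).
* [Schneider1985] P. Schneider, p-adic height pairings II, Invent. Math. 79 (1985) 329–374 — Thm. 2′
  (p. 342), Thm. 7 (p. 371).  [MazurTateTeitelbaum1986Invent] §I.14 Proposition (p. 20).
* [BurungaleCastellaSkinner2025] Thm. 1.1.2 (a).  [GreenbergVatsal2000] Prop. 3.7.  [GreenbergLNM1716]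
  §1 Conj. 1.11, §4.  [Miller2011LMS] Def. 1.1, §6 Example 6.4, Thm. 7.1–7.2.
-/

noncomputable section
open scoped Classical MatrixGroups ModularForm nonZeroDivisors
open CongruenceSubgroup WeierstrassCurve Literature.NumberTheory.EllipticCurves
  Literature.NumberTheory.EllipticCurves.ModularForms
  Literature.NumberTheory.EllipticCurves.BurungaleCastellaSkinner2025
  Literature.NumberTheory.EllipticCurves.GreenbergVatsal2000
  IsDedekindDomain NumberField

namespace Literature.NumberTheory.EllipticCurves.Rank1Residual

/-! ## §1 «`p` is a regular prime for `E`» — the certificate predicate (per pair) -/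

/-- **`p` is a REGULAR prime for `E`** (Stein–Wuthrich 2013, the sentence after Thm. 6.1: `p` is
IRREGULAR for `E` iff the valuation of the leading term of `f_E(T)` is positive), typed on the RIGHT side
of the Perrin-Riou–Schneider leading-term formula (Thm. 6.1): `p ≥ 5` good ordinary, `Ш(E/ℚ)[p^∞]`
finite, and for THE canonical cyclotomic `p`-adic height datum the identity of `p`-adic norms
`‖(1 − α⁻¹)² · #Ш[p^∞] · Reg_p · ∏ c_ℓ‖ = ‖log_p(γ_cyc)^r · #E(ℚ)_tors²‖` (`r = rank E(ℚ)`), i.e.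
`v_p(Reg_p) − r + v_p(∏ c_ℓ) + v_p(#Ш[p^∞]) + 2 v_p(#Ẽ(𝔽_p)) − 2 v_p(#tors) = 0`.  A predicate on the
pair; nothing asserted. [cite: SteinWuthrich2013, §6.1 Thm. 6.1 and the paragraph after it (p. 20)]
[cite: Schneider1985, Thm. 2′ (p. 342) and Thm. 7 (p. 371)] -/
def RegularPrimeAt (W : WeierstrassCurve ℚ) [W.IsElliptic] [W.IsGloballyMinimal] (p : ℕ) [Fact p.Prime] :
    Prop :=
  5 ≤ p ∧ W.HasGoodReductionAtPrime p ∧ ¬ (p : ℤ) ∣ W.frobeniusTrace p ∧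
  Finite (AddCommGroup.primaryComponent W.sha p) ∧
    ‖(1 - (unitRoot W p : ℚ_[p])⁻¹) ^ 2 *
        ((Nat.card (AddCommGroup.primaryComponent W.sha p) : ℚ_[p]) *
          padicRegulator (W.cyclotomicPAdicHeight p) * (W.tamagawaProduct : ℚ_[p]))‖ =
      ‖padicLog p (cyclotomicGenerator p : ℚ_[p]) ^ W.mordellWeilRank * (W.torsionOrder : ℚ_[p]) ^ 2‖

/-! ## §2 What the certificate gives, per pair (proved by name from the tree facts) -/

section PerPair

variable {W : WeierstrassCurve ℚ} [W.IsElliptic] [W.IsGloballyMinimal] {p : ℕ} [Fact p.Prime]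

omit [W.IsGloballyMinimal] in
/-- The right side of the leading-term identity is non-zero: `log_p(γ_cyc) = p · unit ≠ 0` (odd `p`) and
`#tors ≠ 0`. [cite: SteinWuthrich2013, §6.1 Thm. 6.1 (p. 20)] -/
theorem padicLog_cyclotomicGenerator_pow_mul_torsionOrder_sq_ne_zero (hp2 : p ≠ 2) :
    padicLog p (cyclotomicGenerator p : ℚ_[p]) ^ W.mordellWeilRank * (W.torsionOrder : ℚ_[p]) ^ 2 ≠ 0 := by
  have hpP : p.Prime := Fact.out
  obtain ⟨w, hw⟩ := exists_unit_padicLog_cyclotomicGenerator (p := p) hp2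
  have hpQ : (p : ℚ_[p]) ≠ 0 := by exact_mod_cast hpP.ne_zero
  have hw0 : ((w : ℤ_[p]) : ℚ_[p]) ≠ 0 := by
    rw [← norm_ne_zero_iff, PadicInt.padic_norm_e_of_padicInt, PadicInt.norm_units]; exact one_ne_zero
  have hlog0 : padicLog p (cyclotomicGenerator p : ℚ_[p]) ≠ 0 := by
    rw [hw]; exact mul_ne_zero hpQ hw0
  have hTQ : (W.torsionOrder : ℚ_[p]) ≠ 0 := by exact_mod_cast (W.torsionOrder_pos_holds).ne'
  exact mul_ne_zero (pow_ne_zero _ hlog0) (pow_ne_zero 2 hTQ)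

/-- **Regularity forces Schneider's non-degeneracy for THE canonical datum** (`Reg_p ≠ 0`): the right
side of the identity is non-zero, so the left side is, so its factor `Reg_p` is.
[cite: SteinWuthrich2013, §6.1 Thm. 6.1 (p. 20) and §4 Conj. 4.1] -/
theorem RegularPrimeAt.schneiderConjecture (h : RegularPrimeAt W p) :
    SchneiderConjecture (W.cyclotomicPAdicHeight p) := by
  obtain ⟨hp, -, -, -, hI⟩ := h
  have hR := padicLog_cyclotomicGenerator_pow_mul_torsionOrder_sq_ne_zero (W := W) (p := p) (by omega)
  rw [← norm_ne_zero_iff, ← hI, norm_ne_zero_iff] at hR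
  intro h0
  apply hR
  rw [h0, mul_zero, zero_mul, mul_zero]

/-- **Regularity forces Schneider's non-degeneracy for EVERY canonical datum** (uniqueness of the
canonical height, fact `exists_admissible_nsmul`) — the per-pair `∀ Dh, Dh.IsCanonical →` currency.
[cite: SteinWuthrich2013, §4 Conj. 4.1 and §6.1 Thm. 6.1 (p. 20)] -/
theorem RegularPrimeAt.schneiderConjecture_of_isCanonical (hadm : exists_admissible_nsmul)
    (h : RegularPrimeAt W p) (Dh : PAdicHeightData W p) (hDh : Dh.IsCanonical) :
    SchneiderConjecture Dh := by
  rw [eq_cyclotomicPAdicHeight_of_fact hadm hDh]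
  exact h.schneiderConjecture

/-- **Regularity ⟹ `[T^r] f_E` is a `p`-adic unit**, for every cyclotomic dual datum `D` with `X` torsion
and every generator `fE` of `char_Λ X` (Perrin-Riou–Schneider, clause 3 of the tree fact
`Schneider1985_order_charGenerator`, at THE canonical datum, whose existence is the fact
`exists_isCanonical`). [cite: SteinWuthrich2013, §6.1 Thm. 6.1 and the paragraph after it (p. 20)]
[cite: Schneider1985, Thm. 2′ (p. 342) and Thm. 7 (p. 371), clause 3] -/
theorem RegularPrimeAt.norm_coeff_rank_eq_one (hS : Schneider1985_order_charGenerator)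
    (hex : exists_isCanonical) (h : RegularPrimeAt W p)
    {κ : ZpExtension ℚ p} {γ : Field.absoluteGaloisGroup ℚ}
    (hκ : κ.IsCyclotomic) (hγ : κ.IsTopGenerator γ) (hγ' : IsCyclotomicVariable p γ)
    (D : W.SelmerDualData κ γ) [Module.Finite (IwasawaAlgebra p) D.X] (hX : D.IsTorsion)
    {fE : IwasawaAlgebra p} (hchar : D.charIdeal = Ideal.span {fE}) :
    ‖((PowerSeries.coeff W.mordellWeilRank fE : ℤ_[p]) : ℚ_[p])‖ = 1 := by
  have hSch := h.schneiderConjecture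
  obtain ⟨hp, hgood, hord, hfin, hI⟩ := h
  have hDh : (W.cyclotomicPAdicHeight p).IsCanonical :=
    isCanonical_cyclotomicPAdicHeight_of_fact hex hp hgood hord
  obtain ⟨u, heq⟩ :=
    (hS W p hp hgood hord κ γ hκ hγ hγ' D hX fE hchar _ hDh).2.2 hSch hfin
  have hR := padicLog_cyclotomicGenerator_pow_mul_torsionOrder_sq_ne_zero (W := W) (p := p) (by omega)
  have hu : ‖((u : ℤ_[p]) : ℚ_[p])‖ = 1 := by
    rw [PadicInt.padic_norm_e_of_padicInt, PadicInt.norm_units]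
  have hn := congrArg (‖·‖) heq
  simp only [norm_mul] at hn
  rw [hu, one_mul] at hn
  -- hn : ‖c‖ * ‖log^r‖ * ‖tors²‖ = ‖(1-α⁻¹)²‖ * (‖#Ш‖ * ‖Reg‖ * ‖∏c‖)
  have hI' : ‖(1 - (unitRoot W p : ℚ_[p])⁻¹) ^ 2‖ *
      (‖(Nat.card (AddCommGroup.primaryComponent W.sha p) : ℚ_[p])‖ *
        ‖padicRegulator (W.cyclotomicPAdicHeight p)‖ * ‖(W.tamagawaProduct : ℚ_[p])‖) =
      ‖padicLog p (cyclotomicGenerator p : ℚ_[p]) ^ W.mordellWeilRank‖ * ‖(W.torsionOrder : ℚ_[p]) ^ 2‖ := by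
    simpa only [norm_mul] using hI
  rw [hI'] at hn
  have hR' : ‖padicLog p (cyclotomicGenerator p : ℚ_[p]) ^ W.mordellWeilRank‖ *
      ‖(W.torsionOrder : ℚ_[p]) ^ 2‖ ≠ 0 := by
    rw [← norm_mul]; exact norm_ne_zero_iff.mpr hR
  -- `‖c‖ · R = R` with `R ≠ 0`
  have : ‖((PowerSeries.coeff W.mordellWeilRank fE : ℤ_[p]) : ℚ_[p])‖ *
      (‖padicLog p (cyclotomicGenerator p : ℚ_[p]) ^ W.mordellWeilRank‖ * ‖(W.torsionOrder : ℚ_[p]) ^ 2‖) =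
      1 * (‖padicLog p (cyclotomicGenerator p : ℚ_[p]) ^ W.mordellWeilRank‖ * ‖(W.torsionOrder : ℚ_[p]) ^ 2‖) := by
    rw [one_mul, ← mul_assoc, hn]
  exact mul_right_cancel₀ hR' this

/-- **Regularity ⟹ `μ(X(E/ℚ_∞)) = 0` for EVERY cyclotomic dual datum** (`MuAlgZeroAt`), for `E[p]`
irreducible (cotorsion and a generator from Burungale–Castella–Skinner Thm. 1.1.2 (a) at the newform of
modularity): a unit coefficient of a generator of `char_Λ X` is unit content, i.e. `μ = 0`
(`mu_eq_zero_iff_hasUnitContent`). [cite: SteinWuthrich2013, §6.1, paragraph after Thm. 6.1 (p. 20)]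
[cite: BurungaleCastellaSkinner2025, Thm. 1.1.2 (a)] [cite: GreenbergLNM1716, §1 Conj. 1.11] -/
theorem RegularPrimeAt.muAlgZeroAt (hS : Schneider1985_order_charGenerator) (hex : exists_isCanonical)
    (hBCS : burungale_castella_skinner_charIdeal_eq_padicLFunction)
    (hmodP : nonempty_modularParametrizationData) (hirr : W.HasIrreducibleModPGaloisRep p)
    (h : RegularPrimeAt W p) : MuAlgZeroAt W p := by
  intro κ γ hκ hγ hγ' D
  have hp : 5 ≤ p := h.1
  have hgood : W.HasGoodReductionAtPrime p := h.2.1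
  have hord : ¬ (p : ℤ) ∣ W.frobeniusTrace p := h.2.2.1
  haveI : Module.Finite (IwasawaAlgebra p) D.X := D.module_finite_holds hγ
  haveI : NeZero (W.conductorNorm ℤ) := ⟨(W.conductorNorm_pos_holds).ne'⟩
  obtain ⟨Dm⟩ := hmodP W
  obtain ⟨hX, fE, -, hchar, -⟩ := hBCS W p κ γ Dm.f hp hgood hord hirr hκ hγ hγ' Dm.isNewformOf D
  have h1 := h.norm_coeff_rank_eq_one hS hex hκ hγ hγ' D hX hchar
  refine (mu_eq_zero_iff_hasUnitContent D hX hchar).mpr ?_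
  rw [hasUnitContent_iff_exists_norm_eq_one]
  exact ⟨W.mordellWeilRank, by rwa [PadicInt.padic_norm_e_of_padicInt] at h1⟩

/-- **Regularity ⟹ Kato's integral divisibility `𝓛_p(E) · char_Λ X ⊆ Λ` at the pair**
(`KatoDivisibilityAt`), for `E[p]` irreducible — through `μ(X) = 0` for every datum, integrality of
`L_p` (Greenberg–Vatsal Prop. 3.7) and BCS Thm. 1.1.2 (a) (`MuAlgZeroAt.katoDivisibilityAt`); NO analytic
`μ = 0` certificate, NO class group, NO image input beyond irreducibility.
[cite: SteinWuthrich2013, §6.1 (p. 20)] [cite: BurungaleCastellaSkinner2025, Thm. 1.1.2 (a)]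
[cite: GreenbergVatsal2000, Prop. 3.7] -/
theorem RegularPrimeAt.katoDivisibilityAt (hS : Schneider1985_order_charGenerator)
    (hex : exists_isCanonical) (hBCS : burungale_castella_skinner_charIdeal_eq_padicLFunction)
    (hmodP : nonempty_modularParametrizationData) (hirr : W.HasIrreducibleModPGaloisRep p)
    (h : RegularPrimeAt W p) : KatoDivisibilityAt W p :=
  (h.muAlgZeroAt hS hex hBCS hmodP hirr).katoDivisibilityAt hBCS h.1 h.2.1 h.2.2.1 hirr

/-- **Per pair, analytic rank 1 on class X9: regularity + `μ(𝓛_p(E)) = 0` ⟹ Miller's `BSD(E,p)`** —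
`X9.bsdp_of_mu_eq_zero_of_analyticRank_eq_one` fed with `μ(X) = 0` AND the Schneider certificate, both
read off regularity; the analytic certificate in Néron normalisation from `MuAnZeroAt` via the period
unit `h5`. [cite: SteinWuthrich2013, §6.1 Thm. 6.1 (p. 20) and §8] [cite: Miller2011LMS, Def. 1.1]
[cite: GreenbergLNM1716, §1 Conj. 1.11] -/
theorem bsdp_of_regularPrimeAt_of_muAnZeroAt (hS : Schneider1985_order_charGenerator)
    (hex : exists_isCanonical) (hadm : exists_admissible_nsmul)
    (hBCS : burungale_castella_skinner_charIdeal_eq_padicLFunction)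
    (h5 : realPeriodRat_eq_unit_mul_plusPeriod) (hPR : perrinRiou_rankOne_leadingTerms)
    (hmodP : nonempty_modularParametrizationData) (hGZK : rank_eq_analyticRank_of_analyticRank_le_one)
    (hX9 : ClassX9 W p) (hr : W.analyticRank = 1) (hreg : RegularPrimeAt W p) (hμan : MuAnZeroAt W p) :
    BSDp W p := by
  obtain ⟨-, ⟨hgood, hord⟩, hp, hirr, -, -⟩ := id hX9
  exact X9.bsdp_of_mu_eq_zero_of_analyticRank_eq_one W p hBCS h5 hS hPR hmodP hGZK hX9 hr
    (hreg.muAlgZeroAt hS hex hBCS hmodP hirr)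
    (fun f hf ϖ hϖ => hμan.neron h5 hp hgood hirr f hf ϖ hϖ)
    (fun Dh hDh => hreg.schneiderConjecture_of_isCanonical hadm Dh hDh)

end PerPair

/-! ## §3 The λ-FREE instrument: HEIGHT / L-VALUE VALUATION MATCH (Ш-free `p`-adic BSD leading-term valuation) -/

section Match

variable {W : WeierstrassCurve ℚ} [W.IsElliptic] [W.IsGloballyMinimal] {p : ℕ} [Fact p.Prime]

/-- **HEIGHT / L-VALUE VALUATION MATCH at `(E, p)`** (numerical certificate, per pair): for every newform
`f` of `E`, `[T^r] L_p(f, α) ≠ 0` (`r = rank E(ℚ)`) and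
`‖[T^r] L_p(f, α)‖ · ‖log_p(γ_cyc)^r · #tors²‖ = ‖(1 − α⁻¹)² · Reg_p(E) · ∏ c_ℓ‖` (THE canonical cyclotomic
height) — the `p`-adic BSD leading-term identity of Thm. 6.1 / the `p`-adic BSD formula WITHOUT its `Ш`
factor, as an identity of valuations.  Decided per pair by finite-precision numerics on both sides
(`p`-adic regulator §4.2; `p`-adic `L`-series §3; the bound `b_p` of §8).  A predicate; nothing asserted.
[cite: SteinWuthrich2013, §5.1 Conj. 5.1 eq. (5.1) (p. 18) without its `#Ш` factor; §6.1 Thm. 6.1 (p. 20); §8 (pp. 27–28)] -/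
def HeightLValueMatchAt (W : WeierstrassCurve ℚ) [W.IsElliptic] [W.IsGloballyMinimal] (p : ℕ)
    [Fact p.Prime] : Prop :=
  ∀ {N : ℕ} [NeZero N] (f : CuspForm (Gamma0 N) 2), IsNewformOf W f →
    PowerSeries.coeff W.mordellWeilRank (padicLFunction f (unitRoot W p : ℚ_[p])) ≠ 0 ∧
    ‖PowerSeries.coeff W.mordellWeilRank (padicLFunction f (unitRoot W p : ℚ_[p]))‖ *
        ‖padicLog p (cyclotomicGenerator p : ℚ_[p]) ^ W.mordellWeilRank *
          (W.torsionOrder : ℚ_[p]) ^ 2‖ =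
      ‖(1 - (unitRoot W p : ℚ_[p])⁻¹) ^ 2 *
          (padicRegulator (W.cyclotomicPAdicHeight p) * (W.tamagawaProduct : ℚ_[p]))‖

/-- **MATCH ⟹ Schneider's non-degeneracy for THE canonical datum** (the matched right side is non-zero).
[cite: SteinWuthrich2013, §4 Conj. 4.1 and §6.1 Thm. 6.1 (p. 20)] -/
theorem HeightLValueMatchAt.schneiderConjecture (hmodP : nonempty_modularParametrizationData)
    (hM : HeightLValueMatchAt W p) (hp2 : p ≠ 2) :
    SchneiderConjecture (W.cyclotomicPAdicHeight p) := by
  haveI : NeZero (W.conductorNorm ℤ) := ⟨(W.conductorNorm_pos_holds).ne'⟩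
  obtain ⟨Dm⟩ := hmodP W
  obtain ⟨hne, hmatch⟩ := hM Dm.f Dm.isNewformOf
  have hR := padicLog_cyclotomicGenerator_pow_mul_torsionOrder_sq_ne_zero (W := W) (p := p) hp2
  have hL : ‖PowerSeries.coeff W.mordellWeilRank (padicLFunction Dm.f (unitRoot W p : ℚ_[p]))‖ *
      ‖padicLog p (cyclotomicGenerator p : ℚ_[p]) ^ W.mordellWeilRank *
        (W.torsionOrder : ℚ_[p]) ^ 2‖ ≠ 0 :=
    mul_ne_zero (norm_ne_zero_iff.mpr hne) (norm_ne_zero_iff.mpr hR)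
  rw [hmatch, norm_ne_zero_iff] at hL
  intro h0
  apply hL
  rw [h0, zero_mul, mul_zero]

/-- **MATCH ⟹ THE `μ`-DEFECT IS THE `p`-PART OF `Ш`** (λ-free, image-free beyond what Perrin-Riou–Schneider
needs): for every cyclotomic dual datum `D` with `X` torsion, every generator `g` of `char_Λ X` and every
`k` with `ι g = p^k · L_p(f, α)`: `ord_T g = r` (so Schneider holds and `Ш(E)[p^∞]` is finite, clause 2),
and `‖p^k‖ = ‖#Ш(E)[p^∞]‖`, i.e. `k = v_p(#Ш(E)[p^∞])`.  Proof: clause 3 gives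
`‖[T^r] g‖·‖log^r tors²‖ = ‖ε² #Ш Reg ∏c‖`, `ι g = p^k L_p` gives `‖[T^r] g‖ = ‖p^k‖·‖[T^r] L_p‖`, MATCH
gives `‖[T^r] L_p‖·‖log^r tors²‖ = ‖ε² Reg ∏c‖ ≠ 0`; cancel.
[cite: SteinWuthrich2013, §6.1 Thm. 6.1 (p. 20), §8 (pp. 27–28: `b_p`)] [cite: Schneider1985, Thm. 2′ (p. 342) and Thm. 7 (p. 371)] -/
theorem HeightLValueMatchAt.norm_defect_eq_norm_card_sha (hS : Schneider1985_order_charGenerator)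
    (hex : exists_isCanonical) (hM : HeightLValueMatchAt W p)
    (hp : 5 ≤ p) (hgood : W.HasGoodReductionAtPrime p) (hord : ¬ (p : ℤ) ∣ W.frobeniusTrace p)
    {κ : ZpExtension ℚ p} {γ : Field.absoluteGaloisGroup ℚ}
    (hκ : κ.IsCyclotomic) (hγ : κ.IsTopGenerator γ) (hγ' : IsCyclotomicVariable p γ)
    {N : ℕ} [NeZero N] {f : CuspForm (Gamma0 N) 2} (hf : IsNewformOf W f)
    (D : W.SelmerDualData κ γ) [Module.Finite (IwasawaAlgebra p) D.X] (hX : D.IsTorsion)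
    {g : IwasawaAlgebra p} {k : ℤ} (hchar : D.charIdeal = Ideal.span {g})
    (hι : iwasawaToPowerSeries p g =
      PowerSeries.C ((p : ℚ_[p]) ^ k) * padicLFunction f (unitRoot W p : ℚ_[p])) :
    SchneiderConjecture (W.cyclotomicPAdicHeight p) ∧
      Finite (AddCommGroup.primaryComponent W.sha p) ∧
      ‖(p : ℚ_[p]) ^ k‖ = ‖(Nat.card (AddCommGroup.primaryComponent W.sha p) : ℚ_[p])‖ := by
  have hpP : p.Prime := Fact.out
  obtain ⟨hne, hmatch⟩ := hM f hf
  have hcoeff : ((PowerSeries.coeff W.mordellWeilRank g : ℤ_[p]) : ℚ_[p]) =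
      (p : ℚ_[p]) ^ k * PowerSeries.coeff W.mordellWeilRank (padicLFunction f (unitRoot W p : ℚ_[p])) := by
    have h := congrArg (PowerSeries.coeff W.mordellWeilRank) hι
    rw [PowerSeries.coeff_C_mul, PowerSeries.coeff_map] at h
    exact h
  have hpk : (p : ℚ_[p]) ^ k ≠ 0 := zpow_ne_zero _ (by exact_mod_cast hpP.ne_zero)
  have hg_ne : (PowerSeries.coeff W.mordellWeilRank g : ℤ_[p]) ≠ 0 := by
    intro h0
    apply mul_ne_zero hpk hne
    rw [← hcoeff, h0, PadicInt.coe_zero]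
  have hDh : (W.cyclotomicPAdicHeight p).IsCanonical :=
    isCanonical_cyclotomicPAdicHeight_of_fact hex hp hgood hord
  have hPRS := hS W p hp hgood hord κ γ hκ hγ hγ' D hX g hchar _ hDh
  have horder : g.order = W.mordellWeilRank :=
    le_antisymm (PowerSeries.order_le W.mordellWeilRank hg_ne) hPRS.1
  obtain ⟨hSch, hfin⟩ := hPRS.2.1.mp horder
  obtain ⟨u, heq⟩ := hPRS.2.2 hSch hfin
  refine ⟨hSch, hfin, ?_⟩
  have hu : ‖((u : ℤ_[p]) : ℚ_[p])‖ = 1 := by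
    rw [PadicInt.padic_norm_e_of_padicInt, PadicInt.norm_units]
  have hA := congrArg (‖·‖) heq
  simp only [norm_mul] at hA
  rw [hu, one_mul, hcoeff, norm_mul] at hA
  have hM' : ‖PowerSeries.coeff W.mordellWeilRank (padicLFunction f (unitRoot W p : ℚ_[p]))‖ *
      (‖padicLog p (cyclotomicGenerator p : ℚ_[p]) ^ W.mordellWeilRank‖ *
        ‖(W.torsionOrder : ℚ_[p]) ^ 2‖) =
      ‖(1 - (unitRoot W p : ℚ_[p])⁻¹) ^ 2‖ *
        (‖padicRegulator (W.cyclotomicPAdicHeight p)‖ * ‖(W.tamagawaProduct : ℚ_[p])‖) := by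
    simpa only [norm_mul] using hmatch
  have hN : ‖PowerSeries.coeff W.mordellWeilRank (padicLFunction f (unitRoot W p : ℚ_[p]))‖ *
      (‖padicLog p (cyclotomicGenerator p : ℚ_[p]) ^ W.mordellWeilRank‖ *
        ‖(W.torsionOrder : ℚ_[p]) ^ 2‖) ≠ 0 := by
    have hR := padicLog_cyclotomicGenerator_pow_mul_torsionOrder_sq_ne_zero (W := W) (p := p) (by omega)
    rw [← norm_mul, ← norm_mul]
    exact norm_ne_zero_iff.mpr (mul_ne_zero hne hR)
  apply mul_right_cancel₀ hN
  linear_combination hA - ‖(Nat.card (AddCommGroup.primaryComponent W.sha p) : ℚ_[p])‖ * hM'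

omit [W.IsElliptic] [W.IsGloballyMinimal] in
/-- `‖(n : ℚ_p)‖ = 1` for a natural number `n` prime to `p` (plumbing). [folklore] -/
private theorem norm_natCast_eq_one_of_not_dvd {n : ℕ} (hn : ¬ p ∣ n) : ‖(n : ℚ_[p])‖ = 1 := by
  rw [Padic.norm_natCast_eq_one_iff]
  exact (Nat.Prime.coprime_iff_not_dvd (Fact.out : p.Prime)).mpr hn

/-- **MATCH + `p ∤ #Ш(E)[p^∞]` ⟹ the `μ`-defect is `≤ 0` at every datum** (`MuDefectNonposAt`; in fact
`= 0`). [cite: SteinWuthrich2013, §6.1 Thm. 6.1 (p. 20)] [cite: BurungaleCastellaSkinner2025, Thm. 1.1.2 (a)] -/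
theorem HeightLValueMatchAt.muDefectNonposAt (hS : Schneider1985_order_charGenerator)
    (hex : exists_isCanonical) (hM : HeightLValueMatchAt W p)
    (hp : 5 ≤ p) (hgood : W.HasGoodReductionAtPrime p) (hord : ¬ (p : ℤ) ∣ W.frobeniusTrace p)
    (htors : ∀ (κ : ZpExtension ℚ p) (γ : Field.absoluteGaloisGroup ℚ),
      κ.IsCyclotomic → κ.IsTopGenerator γ → IsCyclotomicVariable p γ →
      ∀ D : W.SelmerDualData κ γ, D.IsTorsion)
    (hsha : ¬ p ∣ Nat.card (AddCommGroup.primaryComponent W.sha p)) :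
    MuDefectNonposAt W p := by
  intro κ γ N _ f hκ hγ hγ' hf D g k hg hι
  have hpP : p.Prime := Fact.out
  haveI : Module.Finite (IwasawaAlgebra p) D.X := D.module_finite_holds hγ
  obtain ⟨-, -, hnorm⟩ :=
    hM.norm_defect_eq_norm_card_sha hS hex hp hgood hord hκ hγ hγ' hf D (htors κ γ hκ hγ hγ' D) hg hι
  rw [norm_natCast_eq_one_of_not_dvd hsha, norm_zpow, Padic.norm_p, inv_zpow'] at hnorm
  by_contra hk
  push Not at hk
  have hp1 : (1 : ℝ) < p := by exact_mod_cast hpP.one_lt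
  have hlt : (p : ℝ) ^ (-k) < 1 := zpow_lt_one_of_neg₀ hp1 (by omega)
  rw [hnorm] at hlt
  exact lt_irrefl _ hlt

/-- **MATCH + `p ∤ #Ш(E)[p^∞]` + `μ(𝓛_p(E)) = 0` ⟹ `μ(X(E/ℚ_∞)) = 0` for every cyclotomic dual datum**
(`E[p]` irreducible; cotorsion and the generator from BCS Thm. 1.1.2 (a)): the defect is `0`, so
`ι f_E = L_p` carries the analytic unit coefficient. [cite: SteinWuthrich2013, §6.1 Thm. 6.1 (p. 20)]
[cite: BurungaleCastellaSkinner2025, Thm. 1.1.2 (a)] [cite: GreenbergLNM1716, §1 Conj. 1.11] -/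
theorem HeightLValueMatchAt.muAlgZeroAt (hS : Schneider1985_order_charGenerator) (hex : exists_isCanonical)
    (hBCS : burungale_castella_skinner_charIdeal_eq_padicLFunction)
    (hmodP : nonempty_modularParametrizationData) (hM : HeightLValueMatchAt W p)
    (hp : 5 ≤ p) (hgood : W.HasGoodReductionAtPrime p) (hord : ¬ (p : ℤ) ∣ W.frobeniusTrace p)
    (hirr : W.HasIrreducibleModPGaloisRep p)
    (hsha : ¬ p ∣ Nat.card (AddCommGroup.primaryComponent W.sha p)) (hμan : MuAnZeroAt W p) :
    MuAlgZeroAt W p := by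
  intro κ γ hκ hγ hγ' D
  have hpP : p.Prime := Fact.out
  haveI : Module.Finite (IwasawaAlgebra p) D.X := D.module_finite_holds hγ
  haveI : NeZero (W.conductorNorm ℤ) := ⟨(W.conductorNorm_pos_holds).ne'⟩
  obtain ⟨Dm⟩ := hmodP W
  obtain ⟨hX, fE, k, hchar, hι⟩ := hBCS W p κ γ Dm.f hp hgood hord hirr hκ hγ hγ' Dm.isNewformOf D
  obtain ⟨-, -, hnorm⟩ :=
    hM.norm_defect_eq_norm_card_sha hS hex hp hgood hord hκ hγ hγ' Dm.isNewformOf D hX hchar hι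
  rw [norm_natCast_eq_one_of_not_dvd hsha, norm_zpow, Padic.norm_p, inv_zpow'] at hnorm
  have hp0 : (0 : ℝ) < p := by exact_mod_cast hpP.pos
  have hp1 : (1 : ℝ) < p := by exact_mod_cast hpP.one_lt
  have hk : k = 0 := by
    rw [← zpow_zero (p : ℝ)] at hnorm
    have := zpow_right_injective₀ hp0 hp1.ne' hnorm
    omega
  subst hk
  obtain ⟨n, hn⟩ := hμan Dm.f Dm.isNewformOf
  refine (mu_eq_zero_iff_hasUnitContent D hX hchar).mpr ?_
  rw [hasUnitContent_iff_exists_norm_eq_one]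
  refine ⟨n, ?_⟩
  have hc := congrArg (PowerSeries.coeff n) hι
  rw [PowerSeries.coeff_C_mul, PowerSeries.coeff_map, zpow_zero, one_mul] at hc
  have h1 : ‖((PowerSeries.coeff n fE : ℤ_[p]) : ℚ_[p])‖ = 1 := by
    rw [show ((PowerSeries.coeff n fE : ℤ_[p]) : ℚ_[p]) = algebraMap ℤ_[p] ℚ_[p] (PowerSeries.coeff n fE)
      from rfl, hc]
    exact hn
  rwa [PadicInt.padic_norm_e_of_padicInt] at h1

/-- **THE λ-FREE GLUE, per pair**: MATCH and `p ∤ #Ш(E)[p^∞]` at `p ≥ 5` good ordinary with `E[p]`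
irreducible give Kato's integral divisibility at the pair (`KatoDivisibilityAt`; Perrin-Riou–Schneider,
the canonical height, BCS Thm. 1.1.2 (a), modularity by name; cotorsion `isTorsion_of_bcs`).
[cite: SteinWuthrich2013, §6.1 Thm. 6.1 (p. 20)] [cite: BurungaleCastellaSkinner2025, Thm. 1.1.2 (a)] -/
theorem HeightLValueMatchAt.katoDivisibilityAt (hS : Schneider1985_order_charGenerator)
    (hex : exists_isCanonical) (hBCS : burungale_castella_skinner_charIdeal_eq_padicLFunction)
    (hmodP : nonempty_modularParametrizationData) (hM : HeightLValueMatchAt W p)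
    (hp : 5 ≤ p) (hgood : W.HasGoodReductionAtPrime p) (hord : ¬ (p : ℤ) ∣ W.frobeniusTrace p)
    (hirr : W.HasIrreducibleModPGaloisRep p)
    (hsha : ¬ p ∣ Nat.card (AddCommGroup.primaryComponent W.sha p)) : KatoDivisibilityAt W p :=
  (hM.muDefectNonposAt hS hex hp hgood hord (isTorsion_of_bcs hBCS hmodP hp hgood hord hirr)
    hsha).katoDivisibilityAt hBCS hp hgood hord hirr

/-- **THE λ-FREE LEAF, per pair, analytic rank 1 on class X9**: MATCH, `p ∤ #Ш(E)[p^∞]` and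
`μ(𝓛_p(E)) = 0` give Miller's `BSD(E,p)` — `μ(X) = 0` and the Schneider certificate both read off MATCH.
[cite: SteinWuthrich2013, §6.1 Thm. 6.1 (p. 20) and §8] [cite: Miller2011LMS, Def. 1.1]
[cite: GreenbergLNM1716, §1 Conj. 1.11] -/
theorem bsdp_of_heightLValueMatchAt (hS : Schneider1985_order_charGenerator)
    (hex : exists_isCanonical) (hadm : exists_admissible_nsmul)
    (hBCS : burungale_castella_skinner_charIdeal_eq_padicLFunction)
    (h5 : realPeriodRat_eq_unit_mul_plusPeriod) (hPR : perrinRiou_rankOne_leadingTerms)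
    (hmodP : nonempty_modularParametrizationData) (hGZK : rank_eq_analyticRank_of_analyticRank_le_one)
    (hX9 : ClassX9 W p) (hr : W.analyticRank = 1)
    (hM : HeightLValueMatchAt W p) (hsha : ¬ p ∣ Nat.card (AddCommGroup.primaryComponent W.sha p))
    (hμan : MuAnZeroAt W p) : BSDp W p := by
  obtain ⟨-, ⟨hgood, hord⟩, hp, hirr, -, -⟩ := id hX9
  exact X9.bsdp_of_mu_eq_zero_of_analyticRank_eq_one W p hBCS h5 hS hPR hmodP hGZK hX9 hr
    (hM.muAlgZeroAt hS hex hBCS hmodP hp hgood hord hirr hsha hμan)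
    (fun f hf ϖ hϖ => hμan.neron h5 hp hgood hirr f hf ϖ hϖ)
    (fun Dh hDh => by
      rw [eq_cyclotomicPAdicHeight_of_fact hadm hDh]
      exact hM.schneiderConjecture hmodP (by omega))

end Match

/-! ## §4 The DESCENT Ш-gate (`Ш[p] = 0 ⟹ p ∤ #Ш[p^∞]`), MATCH at rank 0, and the Ш-cell door -/

section Descent

open Typed (MissingLowerBoundAt MissingUpperBoundAt MissingPPartAt missingPPartAt_of_lower_of_upper
  bsdp_of_missingPPartAt)

variable {W : WeierstrassCurve ℚ} [W.IsElliptic] [W.IsGloballyMinimal] {p : ℕ} [Fact p.Prime]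

omit [W.IsGloballyMinimal] in
/-- `Ш[p] = 0` kills every `p`-power-torsion class of `Ш` (bookkeeping for the descent Ш-gate).
[cite: Miller2011LMS, §6 Example 6.4 (arXiv:1010.2431: «hence `#Ш(ℚ,E)[5] = 1` … the 5-primary part is trivial»)] -/
theorem eq_zero_of_pow_nsmul_eq_zero_of_shaPTorsionFreeAt (h : ShaPTorsionFreeAt W p) :
    ∀ (k : ℕ) (x : W.sha), p ^ k • x = 0 → x = 0 := by
  intro k
  induction k with
  | zero => intro x hx; simpa using hx
  | succ k ih =>
    intro x hx
    apply ih
    have h1 : p • (p ^ k • x) = 0 := by rw [← mul_smul, ← pow_succ']; exact hx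
    have h2 : ((p ^ k • x : W.sha) : W.galH1) = 0 :=
      h _ (p ^ k • x).2 (by simpa using congrArg Subtype.val h1)
    exact Subtype.ext h2

omit [W.IsGloballyMinimal] in
/-- **`Ш(E/ℚ)[p] = 0 ⟹ Ш(E/ℚ)[p^∞] = 0`**: the `p`-primary component of `Ш` is trivial (no finiteness
needed). [cite: Miller2011LMS, §6 Example 6.4 (arXiv:1010.2431: «the 5-primary part of `Ш(ℚ,E)` is trivial»)] -/
theorem primaryComponent_sha_eq_bot_of_shaPTorsionFreeAt (h : ShaPTorsionFreeAt W p) :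
    AddCommGroup.primaryComponent W.sha p = ⊥ := by
  refine (AddSubgroup.eq_bot_iff_forall _).mpr fun x hx => ?_
  obtain ⟨k, hk⟩ := (AddCommGroup.mem_primaryComponent).mp hx
  exact eq_zero_of_pow_nsmul_eq_zero_of_shaPTorsionFreeAt h k x hk

omit [W.IsGloballyMinimal] in
/-- `Ш[p] = 0 ⟹ #Ш[p^∞] = 1`. [cite: Miller2011LMS, §6 Example 6.4] -/
theorem natCard_primaryComponent_sha_eq_one_of_shaPTorsionFreeAt (h : ShaPTorsionFreeAt W p) :
    Nat.card (AddCommGroup.primaryComponent W.sha p) = 1 := by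
  rw [primaryComponent_sha_eq_bot_of_shaPTorsionFreeAt h]
  exact AddSubgroup.card_bot

omit [W.IsGloballyMinimal] in
/-- **The Ш-gate from descent**: `Ш(E/ℚ)[p] = 0 ⟹ p ∤ #Ш(E/ℚ)[p^∞]` (the hypothesis `hsha` of §3; a
`p`-descent with `dim Sel_p(E/ℚ) = rank E(ℚ)` and `E(ℚ)[p] = 0` certifies the premise).
[cite: Miller2011LMS, §6 Example 6.4 and Thm. 7.2 proof («3-descent shows that `Ш(ℚ,F)[3] = 0`, and hence `BSD(F,3)`»)] -/
theorem not_dvd_natCard_primaryComponent_sha_of_shaPTorsionFreeAt (h : ShaPTorsionFreeAt W p) :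
    ¬ p ∣ Nat.card (AddCommGroup.primaryComponent W.sha p) := by
  rw [natCard_primaryComponent_sha_eq_one_of_shaPTorsionFreeAt h, Nat.dvd_one]
  exact (Fact.out : p.Prime).one_lt.ne'

/-- **MATCH with the DESCENT certificate as Ш-gate ⟹ Kato divisibility at the pair** (rank-generic; `p ≥ 5`
good ordinary, `E[p]` irreducible). [cite: SteinWuthrich2013, §6.1 Thm. 6.1 (p. 20)] [cite: Miller2011LMS, §6] -/
theorem HeightLValueMatchAt.katoDivisibilityAt_of_shaPTorsionFreeAt
    (hS : Schneider1985_order_charGenerator) (hex : exists_isCanonical)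
    (hBCS : burungale_castella_skinner_charIdeal_eq_padicLFunction)
    (hmodP : nonempty_modularParametrizationData) (hM : HeightLValueMatchAt W p)
    (hp : 5 ≤ p) (hgood : W.HasGoodReductionAtPrime p) (hord : ¬ (p : ℤ) ∣ W.frobeniusTrace p)
    (hirr : W.HasIrreducibleModPGaloisRep p) (hdesc : ShaPTorsionFreeAt W p) : KatoDivisibilityAt W p :=
  hM.katoDivisibilityAt hS hex hBCS hmodP hp hgood hord hirr
    (not_dvd_natCard_primaryComponent_sha_of_shaPTorsionFreeAt hdesc)

omit [W.IsGloballyMinimal] in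
/-- **`Reg_p = 1` at Mordell–Weil rank 0** (the Mordell–Weil basis is empty; the determinant of the empty
Gram matrix is `1`) — for EVERY height datum. [cite: SteinWuthrich2013, §4.2 (the `p`-adic regulator)] -/
theorem padicRegulator_eq_one_of_rank_zero (D : PAdicHeightData W p) (hr : W.mordellWeilRank = 0) :
    padicRegulator D = 1 := by
  classical
  obtain ⟨P, hP⟩ := W.exists_isMordellWeilBasis_holds
  have h : ∃ (n : ℕ) (P : Fin n → W.toAffine.Point), IsMordellWeilBasis P := ⟨_, P, hP⟩
  have hn : h.choose = 0 := by
    have hc := IsMordellWeilBasis.card_eq_holds h.choose_spec.choose_spec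
    rw [Fintype.card_fin, hr] at hc
    exact hc
  rw [padicRegulator, dif_pos h, padicRegulatorOf]
  haveI : IsEmpty (Fin h.choose) := by rw [hn]; infer_instance
  convert Matrix.det_isEmpty (A := PAdicHeightData.pairingMatrix D h.choose_spec.choose)

/-- **MATCH at Mordell–Weil rank 0 is exact arithmetic**: it reads
`L_p(f,α)(0) ≠ 0 ∧ ‖L_p(f,α)(0)‖ · ‖#tors²‖ = ‖(1 − α⁻¹)² · ∏ c_ℓ‖` — no regulator, no `log_p γ`; by the
interpolation `L_p(f,α)(0) = (1 − α⁻¹)² · L(E,1)/Ω_E` it is `v_p(L(E,1)/Ω_E) = v_p(∏ c_ℓ) − 2 v_p(#tors)`,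
i.e. `ord_p #Ш(E/ℚ)_an = 0`, decided exactly per pair by modular symbols.
[cite: SteinWuthrich2013, §3 and §5.1 Conj. 5.1 (p. 18)] [cite: MazurTateTeitelbaum1986Invent, §I.14 Proposition (p. 20)] -/
theorem heightLValueMatchAt_iff_of_rank_zero (hr : W.mordellWeilRank = 0) :
    HeightLValueMatchAt W p ↔
      ∀ {N : ℕ} [NeZero N] (f : CuspForm (Gamma0 N) 2), IsNewformOf W f →
        PowerSeries.coeff 0 (padicLFunction f (unitRoot W p : ℚ_[p])) ≠ 0 ∧
        ‖PowerSeries.coeff 0 (padicLFunction f (unitRoot W p : ℚ_[p]))‖ *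
            ‖(W.torsionOrder : ℚ_[p]) ^ 2‖ =
          ‖(1 - (unitRoot W p : ℚ_[p])⁻¹) ^ 2 * (W.tamagawaProduct : ℚ_[p])‖ := by
  simp only [HeightLValueMatchAt, hr, pow_zero, one_mul,
    padicRegulator_eq_one_of_rank_zero (W.cyclotomicPAdicHeight p) hr]

omit [W.IsGloballyMinimal] in
/-- **`ShaPRankAtLeast W p d` — a descent LOWER bound**: `Ш(E/ℚ)` contains a subgroup killed by `p` of
order `p^d` (a `p`-descent exhibits `d = dim Sel_p(E/ℚ) − rank E(ℚ)` independent classes when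
`E(ℚ)[p] = 0`).  A predicate. [cite: Miller2011LMS, Thm. 7.1–7.2 proofs («a 3-descent proves `Ш(ℚ,E)[3] ≅ (ℤ/3ℤ)²`»)] -/
def ShaPRankAtLeast (W : WeierstrassCurve ℚ) [W.IsElliptic] (p : ℕ) (d : ℕ) : Prop :=
  ∃ H : AddSubgroup W.galH1, H ≤ W.sha ∧ (∀ c ∈ H, p • c = 0) ∧ Nat.card H = p ^ d

omit [W.IsGloballyMinimal] in
/-- **Descent lower bound ⟹ Miller's lower half** `ord_p #Ш_an ≤ ord_p #Ш` at a pair with `Ш` finite and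
`ord_p #Ш_an ≤ d`. [cite: Miller2011LMS, Def. 1.1 and Thm. 7.1–7.2 proofs] -/
theorem missingLowerBoundAt_of_shaPRankAtLeast (hfin : Finite W.sha) {q : ℚ} (hq : shaAn W = (q : ℂ))
    {d : ℕ} (hv : padicValRat p q ≤ d) (hH : ShaPRankAtLeast W p d) : MissingLowerBoundAt W p := by
  obtain ⟨H, hle, -, hcard⟩ := hH
  refine ⟨q, hq, hv.trans ?_⟩
  have hdvd : p ^ d ∣ W.shaOrder := by
    rw [WeierstrassCurve.shaOrder, ← hcard]
    exact AddSubgroup.card_dvd_of_le hle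
  have hne : W.shaOrder ≠ 0 := (W.shaOrder_pos hfin).ne'
  exact_mod_cast (padicValNat_dvd_iff_le hne).mp hdvd

omit [W.IsGloballyMinimal] in
/-- **THE Ш-CELL DOOR**: in analytic rank `≤ 1` (Gross–Zagier–Kolyvagin: `Ш` finite), an Euler-system UPPER
half `ord_p #Ш ≤ ord_p #Ш_an` plus a descent LOWER bound `p^d ∣ #Ш` with `ord_p #Ш_an ≤ d` give Miller's
`BSD(E,p)` (Miller's procedure for the curves with `ord_p #Ш_an = 2`: descent lower bound + Stein–Wuthrich
upper bound). [cite: Miller2011LMS, Def. 1.1 and Thm. 7.1–7.2 proofs (arXiv:1010.2431)] -/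
theorem bsdp_of_missingUpperBoundAt_of_shaPRankAtLeast
    (hGZK : rank_eq_analyticRank_of_analyticRank_le_one) (hr : W.analyticRank ≤ 1)
    (hu : MissingUpperBoundAt W p) {q : ℚ} (hq : shaAn W = (q : ℂ)) {d : ℕ} (hv : padicValRat p q ≤ d)
    (hH : ShaPRankAtLeast W p d) : BSDp W p := by
  obtain ⟨-, hfin⟩ := hGZK W hr
  exact bsdp_of_missingPPartAt W p hGZK hr
    (missingPPartAt_of_lower_of_upper W p (missingLowerBoundAt_of_shaPRankAtLeast hfin hq hv hH) hu)

end Descent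

end Literature.NumberTheory.EllipticCurves.Rank1Residual

end
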